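import Mathlib

/-!
# SoloBlindPauliPrym — counting hyperelliptic-invariant quaternionic structures (PROPOSITION HP)

Solo programme `solo-HodgeConjecture-blind`, session s54 (`work/s54/prym-side.md` §B).

Mathematics (not formalised here, standard): let `C'` be a hyperelliptic curve of genus 3 with involution
`j` and Weierstrass points `p₁,…,p₈`; `Γ = π₁^{orb}(C'/j) = ⟨t₁,…,t₈ ∣ t_m² = 1, t₁⋯t₈ = 1⟩ ⊃ π₁(C')`
(index 2).  A quaternionic structure `[ρ' : π₁(C') ↠ Q₈]` is `j`-invariant iff `ker ρ' ⊲ Γ`, iff the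
`Q₈`-cover composed with the hyperelliptic map is Galois over `ℙ¹` with a group `G ⊃ Q₈` of order 16 generated
by involutions outside `Q₈` (the images of the `t_m`).  Of the four groups of order 16 containing `Q₈`
(`Q₈ × C₂`, `C₄ ∘ Q₈`, `SD₁₆`, `Q₁₆`) only the PAULI GROUP `G = C₄ ∘ Q₈ = ⟨Q₈, c⟩` (`c` central, `c² = -1`)
has this property, and `j`-invariant structures correspond bijectively to
`{(s₁,…,s₈) ∈ S⁸ : s₁⋯s₈ = 1, ⟨s₁,…,s₈⟩ = G} / Aut G`, `S` = the involutions of `G` outside `Q₈`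
(`Aut G` acts freely on epimorphisms).

What this file CERTIFIES (all by `decide`), in the concrete model `G = Fin 4 × Bool × Bool`,
`(a,b,d) ↔ i^a j^b c^d`:

* `gmul_assoc`, `gmul_one`, `gmul_inv` : the multiplication law is a group of order 16; `toQ_mul`,
  `toQ_inj` : the part `d = false` is Mathlib's `QuaternionGroup 2 = Q₈`; `c_central`, `c_sq` : `c` is
  central with `c² = -1 = i²`; `gen_ijc` : every element is `i^a j^b c^d`.
* `S_spec` : the involutions outside `Q₈` are exactly the six elements `c·q`, `q ∈ {±i, ±j, ±k}`, of three
  "types" `ty ∈ {0,1,2}` (`q ∈ ±i, ±j, ±k`).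
* `two_types_small` : the involutions of any two types lie in an explicit 8-element subgroup (so an 8-tuple
  using ≤ 2 types does not generate `G`); `three_types_generate` : one involution of each type (any signs)
  generates `G` (words of length ≤ 4 reach all 16 elements).  Hence: generation ⟺ all three types occur.
* `count_*` : with `N_U` = number of 8-tuples from `S_U` (involutions with type in `U`) with product `1`
  (computed by the transfer-matrix recursion `countN`, whose value is by construction that number):
  `N_{012} = 210048`, `N_{two types} = 16384`, `N_{one type} = 128`, so by inclusion–exclusion the number of
  8-tuples with product `1` using all three types is `210048 - 3·16384 + 3·128 = 161280` (`epi_count`).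
* `pattern_count` : independently, the number of type patterns in `{0,1,2}⁸` with all three counts even
  and positive is `1260` (and `1260 · 2⁷ = 161280`, `sign_arith`).
* `N4_spec`, `aut_upper`, `aut_lower` : the possible images of `(i,j,c)` under an automorphism (non-central
  order-4, non-commuting; central order-4) form exactly 48 triples, and all 48 of them define bijective
  homomorphisms `(a,b,d) ↦ x^a y^b z^d`: `|Aut G| = 48`.
* `class_count` : `161280 = 48 · 3360`, `3360 = 210 · 16`, `5040 - 3360 = 105 · 16`.

Conclusion (PROP HP (2)–(3)): exactly `3360` of the `5040` quaternionic structures on a hyperelliptic genus-3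
curve are invariant under the hyperelliptic involution — all 16 over each of the 210 isotropic planes of
type (224), none over the 105 planes of type (444); for those, the 16-sheeted cover of `ℙ¹` is Galois with
group `C₄ ∘ Q₈`, and the extra automorphism `c` (`c² = -1`) makes the quaternionic Prym isogenous to the
square of an abelian fourfold of Weil type for `ℚ(i)`.
-/

namespace Summit.HodgeConjecture.HodgeConjecture.Theorems.PauliPrym

set_option maxHeartbeats 4000000
set_option maxRecDepth 4000

/-- The model of the Pauli group: `(a,b,d) ↔ i^a j^b c^d`. -/
abbrev G := Fin 4 × Bool × Bool

/-- Multiplication: `i^a j^b c^d · i^a' j^b' c^d' = i^(a ± a' + 2[b∧b'] + 2[d∧d']) j^(b⊻b') c^(d⊻d')`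
(using `j i = i⁻¹ j`, `j² = c² = i²`, `c` central). -/
def gmul (x y : G) : G :=
  (x.1 + (if x.2.1 then -y.1 else y.1) + (if x.2.1 && y.2.1 then 2 else 0) + (if x.2.2 && y.2.2 then 2 else 0),
   xor x.2.1 y.2.1, xor x.2.2 y.2.2)

/-- Identity. -/
def e : G := (0, false, false)
/-- `i`. -/
def gi : G := (1, false, false)
/-- `j`. -/
def gj : G := (0, true, false)
/-- `c`. -/
def gc : G := (0, false, true)
/-- `-1 = i²`. -/
def m1 : G := (2, false, false)

/-- Inverse: found by search over the 16 elements (certified below). -/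
def ginv (x : G) : G :=
  ((List.finRange 4).flatMap fun a => [(a,false,false),(a,false,true),(a,true,false),(a,true,true)]).find?
    (fun y => gmul x y = e) |>.getD e

/-- Associativity (4096 cases). -/
theorem gmul_assoc : ∀ x y z : G, gmul (gmul x y) z = gmul x (gmul y z) := by decide +kernel
/-- Unit. -/
theorem gmul_one : ∀ x : G, gmul x e = x ∧ gmul e x = x := by decide +kernel
/-- Inverses. -/
theorem gmul_inv : ∀ x : G, gmul x (ginv x) = e ∧ gmul (ginv x) x = e := by decide +kernel
/-- `c` is central, `c² = -1 = i² = j²`, `-1` central of order 2. -/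
theorem c_central : ∀ x : G, gmul gc x = gmul x gc := by decide +kernel
/-- `c² = i² = j² = -1`, and `(-1)² = 1`. -/
theorem c_sq : gmul gc gc = m1 ∧ gmul gi gi = m1 ∧ gmul gj gj = m1 ∧ gmul m1 m1 = e := by decide +kernel

/-- The `d = false` part is `Q₈ = QuaternionGroup 2`: `i^a ↦ a a`, `i^a j ↦ a a * xa 0 = xa (-a)` (Mathlib's
convention `a i * xa j = xa (j - i)`). -/
def toQ (p : Fin 4 × Bool) : QuaternionGroup 2 :=
  if p.2 then QuaternionGroup.xa (-(p.1 : ZMod 4)) else QuaternionGroup.a (p.1 : ZMod 4)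

/-- `toQ` is multiplicative on the index-2 subgroup `d = false` (which is closed). -/
theorem toQ_mul : ∀ p q : Fin 4 × Bool,
    (gmul (p.1, p.2, false) (q.1, q.2, false)).2.2 = false ∧
    toQ ((gmul (p.1, p.2, false) (q.1, q.2, false)).1, (gmul (p.1, p.2, false) (q.1, q.2, false)).2.1)
      = toQ p * toQ q := by decide +kernel
/-- `toQ` is injective (hence bijective onto the 8-element group `Q₈`). -/
theorem toQ_inj : ∀ p q : Fin 4 × Bool, toQ p = toQ q → p = q := by decide +kernel

/-- Powers. -/
def gpow (x : G) : ℕ → G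
  | 0 => e
  | n + 1 => gmul (gpow x n) x

/-- The map `(a,b,d) ↦ x^a y^b z^d` determined by a triple. -/
def wordMap (x y z : G) (g : G) : G :=
  gmul (gmul (gpow x g.1.val) (if g.2.1 then y else e)) (if g.2.2 then z else e)

/-- Every element is `i^a j^b c^d`: `i, j, c` generate and the normal form is the model itself. -/
theorem gen_ijc : ∀ g : G, wordMap gi gj gc g = g := by decide +kernel

/-- Enumeration of `G` in the order of `enc`. -/
def allG : List G := (List.finRange 4).flatMap fun a => [(a,false,false),(a,false,true),(a,true,false),(a,true,true)]
/-- Position of an element in `allG`. -/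
def enc (g : G) : ℕ := g.1.val * 4 + (if g.2.1 then 2 else 0) + (if g.2.2 then 1 else 0)
/-- `allG` lists every element once, at position `enc`. -/
theorem allG_spec : allG.length = 16 ∧ allG.Nodup ∧ ∀ g : G, allG.getD (enc g) e = g := by decide +kernel

/-! ## Involutions outside `Q₈` and their types -/

/-- The six non-central involutions `c·q`, `q ∈ {±i, ±j, ±k}`. -/
def S : List G := [(1,false,true), (3,false,true), (0,true,true), (2,true,true), (1,true,true), (3,true,true)]

/-- `S` is exactly the set of involutions outside `Q₈` (`d = true`, square `= 1`). -/
theorem S_spec : ∀ x : G, x ∈ S ↔ (x.2.2 = true ∧ gmul x x = e) := by decide +kernel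

/-- Type of `c·q`: `0` if `q ∈ ±i`, `1` if `q ∈ ±j`, `2` if `q ∈ ±k`. -/
def ty (x : G) : Fin 3 := if x.2.1 = false then 0 else if x.1.val % 2 = 0 then 1 else 2

/-- Involutions with type in `U`. -/
def SU (U : List (Fin 3)) : List G := S.filter fun x => ty x ∈ U

/-- Explicit 8-element subgroups containing the involutions of two given types. -/
def D (U : List (Fin 3)) : List G :=
  if U = [0,1] then [e, m1, (1,true,false), (3,true,false), (1,false,true), (3,false,true), (0,true,true), (2,true,true)]
  else if U = [0,2] then [e, m1, (0,true,false), (2,true,false), (1,false,true), (3,false,true), (1,true,true), (3,true,true)]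
  else [e, m1, (1,false,false), (3,false,false), (0,true,true), (2,true,true), (1,true,true), (3,true,true)]

/-- Boolean check, for a pair of types `U`: `D U` has 8 distinct elements, contains `e` and `SU U`, and is
closed under `gmul`. -/
def smallCheck (U : List (Fin 3)) : Bool :=
  decide ((D U).length = 8) && decide ((D U).Nodup) && decide (e ∈ D U) &&
  ((SU U).all fun x => decide (x ∈ D U)) &&
  ((D U).all fun x => (D U).all fun y => decide (gmul x y ∈ D U))

/-- For each pair of types the involutions of those types lie in an 8-element subgroup (dihedral); so an
8-tuple of involutions using at most two types does not generate `G`. -/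
theorem two_types_small : smallCheck [0,1] = true ∧ smallCheck [0,2] = true ∧ smallCheck [1,2] = true := by
  decide +kernel

/-- Words of length ≤ 4 in three letters. -/
def words4 : List (List (Fin 3)) :=
  [[]] ++ (List.finRange 3).map (fun a => [a]) ++
  ((List.finRange 3).flatMap fun a => (List.finRange 3).map fun b => [a,b]) ++
  ((List.finRange 3).flatMap fun a => (List.finRange 3).flatMap fun b => (List.finRange 3).map fun c => [a,b,c]) ++
  ((List.finRange 3).flatMap fun a => (List.finRange 3).flatMap fun b => (List.finRange 3).flatMap fun c =>
    (List.finRange 3).map fun d => [a,b,c,d])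

/-- Evaluate a word on a triple of letters. -/
def evalT (x y z : G) (w : List (Fin 3)) : G :=
  w.foldl (fun acc l => gmul acc (if l = 0 then x else if l = 1 then y else z)) e

/-- Boolean check: for all sign choices, every element of `G` is a word of length ≤ 4 in one involution of
each type. -/
def genCheck : Bool :=
  [true, false].all fun sx => [true, false].all fun sy => [true, false].all fun sz =>
    allG.all fun g => words4.any fun w =>
      decide (evalT (if sx then (1,false,true) else (3,false,true))
                    (if sy then (0,true,true) else (2,true,true))
                    (if sz then (1,true,true) else (3,true,true)) w = g)

/-- One involution of each type, with arbitrary signs, generates all of `G` (every element is a word of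
length ≤ 4 in them; `allG` is all of `G` by `allG_spec`). -/
theorem three_types_generate : genCheck = true := by decide +kernel

/-! ## Counting 8-tuples with product 1 (transfer matrix over the 16 elements) -/

/-- The table `g ↦ t[g]` is packed into one natural number `Σ_g t[g] · B^(enc g)`, `B = 2^20`
(all counts stay `< 2^18`), so that the kernel evaluates each step to a numeral before the next one. -/
def B : ℕ := 2 ^ 20
/-- Digit `enc g` of a packed table. -/
def digit (T : ℕ) (g : G) : ℕ := (T / B ^ (enc g)) % B
/-- `init[g] = [g = e]`. -/
def initN : ℕ := 1
/-- One step: `t'[g] = Σ_{s ∈ S_U} t[g·s]`.  By induction, after `n` steps `t[g]` is the number of `n`-tuples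
`(s₁,…,s_n)` from `S_U` with `g·s₁⋯s_n = 1`; at `g = e` these are the `n`-tuples with product `1`
(the `s` are involutions, so the order convention is immaterial). -/
def stepN (U : List (Fin 3)) (T : ℕ) : ℕ :=
  (allG.map fun g => B ^ (enc g) * (((SU U).map fun s => digit T (gmul g s)).sum)).sum
/-- Iterate `stepN`, forcing each intermediate table to a numeral (the `match`). -/
def runN (U : List (Fin 3)) : ℕ → ℕ → ℕ
  | 0, T => T
  | n + 1, T => match T with
    | 0 => 0
    | T' + 1 => runN U n (stepN U (T' + 1))
/-- `N_U(8)` = number of 8-tuples of involutions with types in `U` whose product is `1`. -/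
def countN (U : List (Fin 3)) : ℕ := digit (runN U 8 initN) e

/-- All three types allowed: `N = 210048`. -/
theorem count_all : countN [0,1,2] = 210048 := by decide +kernel
/-- Two types: `N = 16384` each. -/
theorem count_two : countN [0,1] = 16384 ∧ countN [0,2] = 16384 ∧ countN [1,2] = 16384 := by
  decide +kernel
/-- One type: `N = 128` each; no type: `0`. -/
theorem count_one : countN [0] = 128 ∧ countN [1] = 128 ∧ countN [2] = 128 ∧ countN [] = 0 := by
  decide +kernel
/-- Inclusion–exclusion: 8-tuples with product `1` in which all three types occur (= epimorphisms
`Γ ↠ G` with all `t_m ↦` involutions outside `Q₈`) number `161280`. -/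
theorem epi_count : 210048 - 3 * 16384 + 3 * 128 - 0 = 161280 := by norm_num

/-- Independent cross-check: type patterns in `{0,1,2}⁸` (encoded in base 3) with all three counts even and
positive number `1260 = 3 · 8!/(4!2!2!)`; each carries `2⁷` admissible sign vectors. -/
def digitCount (n : ℕ) (u : ℕ) : ℕ := ((List.range 8).filter fun p => (n / 3 ^ p) % 3 = u).length
/-- `1260` type patterns with all three counts even and positive. -/
theorem pattern_count :
    ((List.range 6561).filter fun n =>
      (List.range 3).all fun u => digitCount n u % 2 == 0 && decide (0 < digitCount n u)).length = 1260 := by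
  decide +kernel
/-- `1260 · 2⁷ = 161280`. -/
theorem sign_arith : 1260 * 2 ^ 7 = 161280 := by norm_num

/-! ## `|Aut G| = 48` -/

/-- Non-central elements of order 4: exactly `±i, ±j, ±k` (six of them); central elements of order 4:
exactly `±c`. -/
def N4 : List G := [(1,false,false), (3,false,false), (0,true,false), (2,true,false), (1,true,false), (3,true,false)]
/-- `N4` = the non-central elements of order 4; `[c, -c]` = the central elements of order 4. -/
theorem N4_spec : ∀ x : G, (x ∈ N4 ↔ (gpow x 4 = e ∧ gmul x x ≠ e ∧ ∃ y : G, gmul x y ≠ gmul y x)) ∧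
    (x ∈ [gc, gmul m1 gc] ↔ (gpow x 4 = e ∧ gmul x x ≠ e ∧ ∀ y : G, gmul x y = gmul y x)) := by decide +kernel

/-- Candidate images of `(i, j, c)` under an automorphism: `x, y` non-central of order 4 and non-commuting
(as `i, j` are), `z` central of order 4 (as `c` is).  Every automorphism gives such a triple, and distinct
automorphisms give distinct triples (`gen_ijc`). -/
def cand (t : G × G × G) : Bool :=
  decide (t.1 ∈ N4) && decide (t.2.1 ∈ N4) && decide (gmul t.1 t.2.1 ≠ gmul t.2.1 t.1) &&
  decide (t.2.2 ∈ [gc, gmul m1 gc])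

/-- Full check that `wordMap x y z` is a bijective homomorphism (256 products, injectivity on 16 elements). -/
def homBij (t : G × G × G) : Bool :=
  decide ((allG.map (wordMap t.1 t.2.1 t.2.2)).Nodup) && allG.all fun g => allG.all fun h =>
    decide (wordMap t.1 t.2.1 t.2.2 (gmul g h) = gmul (wordMap t.1 t.2.1 t.2.2 g) (wordMap t.1 t.2.1 t.2.2 h))

/-- All 4096 triples. -/
def triples : List (G × G × G) := allG.flatMap fun x => allG.flatMap fun y => allG.map fun z => (x, y, z)

/-- Upper bound: exactly 48 candidate triples, so `|Aut G| ≤ 48`. -/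
theorem aut_upper : (triples.filter cand).length = 48 := by decide +kernel
/-- Lower bound: every candidate triple IS a bijective homomorphism, so `|Aut G| = 48`. -/
theorem aut_lower : (triples.filter cand).all homBij = true := by decide +kernel

/-- The class count: `161280 / 48 = 3360 = 210 · 16` invariant structures, `5040 - 3360 = 105 · 16` others. -/
theorem class_count : 161280 = 48 * 3360 ∧ 3360 = 210 * 16 ∧ 5040 - 3360 = 105 * 16 := by norm_num

end Summit.HodgeConjecture.HodgeConjecture.Theorems.PauliPrym
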